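import Summits.Ventures.PercRepro.S1KillMixedCells
import Summits.Ventures.PercRepro.S1ChainCoNullCellsTP
import Summits.Ventures.PercRepro.S1CellNineThirteen
import Summits.Ventures.PercRepro.S1SeriesLever

/-!
# PercRepro — THE CELL `(9, 9)` MODULO THE CAP TABLE AT `t ≥ 6` (p2, gen 26; SUBCLAIM-S1 §6.10)

The second cell of row `9`. The coloop cases `c = 1, 2` close on the pruned conull consumer at the lever caps
(`125 / 922` on `17` points, `132 / 946` on `16`; worst margins `+18,448` and `+46,490`), `c ≥ 3` is lossy. The
coloop-free case closes on the MIXED kill consumer (S1KillMixedCells) at the lever cap `120` for `t ≤ 5` — the lines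
`t = 0, 1, 2` need `3 / 2 / 1` four-circuits in the kill next to the `0 / 1 / 2` triangles (margins `+1,835 / +1,694 /
+1,552`; the plain line at `t = 0` is `−2,026`) — and needs, at `t ≥ 6`, the four-circuit caps
`116 / 110 / 103 / 95 / 88 / 81 / 73 / 66 / 58 / 51` at `t = 6 … 15` (exact twin mining/p2/g26/caps99.py, needs9b.py).

* `gb_cap_nine` — the series-class cap at nullity `9`; `capNineNineT`, `mkNineNine`, `m4NineNine`, `rrNineNine` — the
  tables;
* **`c025_core_nine_nine_of_cap`** — `RLS` at `(9, 4)` on every `e`-free core of rank `9` with `18` points, provided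
  (P9,9): «every coloop-free `e`-free matroid of nullity `9` with `18` points and `t ≥ 6` triangles has at most
  `capNineNineT t` four-circuits».
Axioms: standard.
-/

open scoped Matroid

namespace PercRepro

namespace S1

open Set

variable {α : Type}

/-- **The series-class cap at nullity `9`**: `s₄ ≤ gb 9 n` on the coloop-free part. -/
theorem gb_cap_nine (p n S : ℕ) (hn : n = p + 9) (hv : gb 9 n = S) : ∀ (N : Matroid α) [N.Finite],
    (∀ e ∈ N.E, ∃ A ⊆ N.E \ {e}, e ∉ N.closure A ∧ e ∉ N.closure ((N.E \ {e}) \ A)) →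
    N.E.encard = N.eRank + ((9 : ℕ) : ℕ∞) → N.E.ncard = p + 9 → N.coloops = ∅ →
    {C : Set α | N.IsCircuit C ∧ C.ncard = 4}.ncard ≤ S := by
  intro N _ hfree hd hn' hcol
  have h := ncard_fourCircuits_le_gb_of_coloopFree N hfree hd hcol hn'
  rwa [← hn, hv] at h

/-- The four-circuit cap of the coloop-free lines of `(9, 9)` at triangle count `t`: the lever cap `120` for
`t ≤ 5`, then `116, 110, 103, 95, 88, 81, 73, 66, 58, 51` at `t = 6 … 15`. -/
def capNineNineT (t : ℕ) : ℕ :=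
  [120, 120, 120, 120, 120, 120, 116, 110, 103, 95, 88, 81, 73, 66, 58, 51].getD t 51

/-- The triangles in the kill at each `t`: `t` itself up to `7`, then `7`. -/
def mkNineNine (t : ℕ) : ℕ := min t 7

/-- The four-circuits in the kill at each `t`: `3, 2, 1` at `t = 0, 1, 2`, none beyond. -/
def m4NineNine (t : ℕ) : ℕ := [3, 2, 1].getD t 0

/-- The chain length `r` at each `t = s₃` for the coloop cases `c = 1, 2` (`P = 15`, resp. `16`). -/
def rrNineNine (t : ℕ) : ℕ := [0, 1, 2, 3, 3, 4, 5, 5, 6, 6, 6, 7, 8, 8, 9, 9, 9].getD t 0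

/-- **THE CELL `(9, 9)` MODULO THE CAP TABLE AT `t ≥ 6`**: `RLS` at `(9, 4)` on every `e`-free core of rank `9` with
`18` points, provided every coloop-free `e`-free matroid of nullity `9` with `18` points and `t ≥ 6` triangles has at
most `capNineNineT t` four-circuits. -/
theorem c025_core_nine_nine_of_cap (M : Matroid α) [M.Finite] (hR : M.eRank = (9 : ℕ)) (hn : M.E.ncard = 18)
    (hfree : ∀ e ∈ M.E, ∃ A ⊆ M.E \ {e}, e ∉ M.closure A ∧ e ∉ M.closure ((M.E \ {e}) \ A))
    (hcap : ∀ (N : Matroid α) [N.Finite],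
      (∀ e ∈ N.E, ∃ A ⊆ N.E \ {e}, e ∉ N.closure A ∧ e ∉ N.closure ((N.E \ {e}) \ A)) →
      N.E.encard = N.eRank + ((9 : ℕ) : ℕ∞) → N.E.ncard = 18 → N.coloops = ∅ →
      ∀ t, 6 ≤ t → {C : Set α | N.IsCircuit C ∧ C.ncard = 3}.ncard = t →
      {C : Set α | N.IsCircuit C ∧ C.ncard = 4}.ncard ≤ capNineNineT t) :
    ThmN.RLS M 9 4 := by
  rcases (show M.coloops.ncard = 0 ∨ M.coloops.ncard = 1 ∨ M.coloops.ncard = 2 ∨ 3 ≤ M.coloops.ncard by omega)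
    with h | h | h | h
  · have hcol : M.coloops = ∅ := (Set.ncard_eq_zero (M.ground_finite.subset M.coloops_subset_ground)).1 h
    refine rls_of_kill_case_mixed_capT M (p := 9) (d := 9) hR hn hfree hcol (by norm_num) (by norm_num)
      (P := 15) (S5 := 901) capNineNineT (by decide) ?_ (by decide) mkNineNine m4NineNine (by decide)
      (by decide +kernel) (by decide +kernel)
    intro N _ hNfree hNd hNn hNcol t ht
    rcases Nat.lt_or_ge t 6 with h6 | h6
    · have hg := gb_cap_nine 9 18 120 rfl (by decide) N hNfree hNd hNn hNcol
      have hc : capNineNineT t = 120 := by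
        unfold capNineNineT
        interval_cases t <;> rfl
      rw [hc]; exact hg
    · exact hcap N hNfree hNd hNn hNcol t h6 ht
  · refine rls_of_ladder_case_chain_conull_capTP M (p := 8) (c := 1) (d := 9) (by norm_num) (by norm_num) hR hn hfree h
      (by norm_num) (by norm_num) (P := 15) (S5 := 922) (fun _ => 125) (by decide) ?_
      (by decide) rrNineNine (by decide) (by decide +kernel) (by decide +kernel) (by decide +kernel)
    intro N _ hNfree hNd hNn hNcol t _
    exact gb_cap_nine 8 17 125 rfl (by decide) N hNfree hNd hNn hNcol
  · refine rls_of_ladder_case_chain_conull_capTP M (p := 7) (c := 2) (d := 9) (by norm_num) (by norm_num) hR hn hfree h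
      (by norm_num) (by norm_num) (P := 16) (S5 := 946) (fun _ => 132) (by decide) ?_
      (by decide) rrNineNine (by decide) (by decide +kernel) (by decide +kernel) (by decide +kernel)
    intro N _ hNfree hNd hNn hNcol t _
    exact gb_cap_nine 7 16 132 rfl (by decide) N hNfree hNd hNn hNcol
  · exact rls_of_coloops_lossy M (p := 6) (c := 3) (hR.trans (by norm_num)) (by norm_num) h phiK_nine_four_le

end S1

end PercRepro
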